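import Mathlib

/-!
# DigitLaw sketch (crux-ideate r1 seat 1, g16) — Néron-scalar bookkeeping of a `p`-isogeny step
between additive potentially good fibres, `p ≥ 5`, twist-minimal rows (types II, III, IV, IV*, III*, II*).

For a `ℚ_p`-rational `p`-isogeny `E → E' = E/C` with both curves additive potentially good at `p`,
acquiring good reduction over a totally (tamely) ramified `T/ℚ_p^{nr}` of degree `e = 12/gcd(12, v_p Δ)`:
`v_p Δ_min(E') − v_p Δ_min(E) = 12 (v_p a_T − v_p a_ℚ)` where `a_ℚ ∈ {1, p}` is the Néron scalar of the
isogeny over `ℤ_p` and `a_T` the Oort–Tate cotangent parameter of the closure of `C` in the good model over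
`O_T` (`v_p a_T = aT/e`, `0 ≤ aT ≤ e`).  Ordinary closure (étale or multiplicative) means `aT ∈ {0, e}`.
Everything below is the finite integer bookkeeping; the arithmetic inputs are in the note
`Ideas/ordinary-cm-torsor-g16-digit.md` §2.  BSD is not proved by this; Manin `c = 1` is not proved by this.
-/

namespace Summit.BirchSwinnertonDyer.BirchSwinnertonDyer.Cruxes.EisensteinAdditiveManinResidual.DigitLaw

/-- `v = v_p(Δ_min)` of a twist-minimal additive potentially good fibre together with its index `e`. -/
def TypeWithIndex (v e : ℤ) : Prop :=
  (v = 2 ∨ v = 10) ∧ e = 6 ∨ (v = 3 ∨ v = 9) ∧ e = 4 ∨ (v = 4 ∨ v = 8) ∧ e = 3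

/-- The balance `e (v' − v) = 12 aT − 12 e aQ` of one isogeny step. -/
def Balance (v v' e aT aQ : ℤ) : Prop :=
  e * (v' - v) = 12 * aT - 12 * e * aQ

/-- (D2) ORDINARY rows: the closure of the kernel is étale (`aT = 0`) or multiplicative (`aT = e`);
then the `p`-isogeny PRESERVES the Kodaira type, and étale closure ⟺ `a_ℚ = 1` (ÉtaleExit). -/
theorem ordinary_step (v v' e aT aQ : ℤ) (hv : TypeWithIndex v e) (hv' : TypeWithIndex v' e)
    (haT : 0 ≤ aT ∧ aT ≤ e) (haQ : aQ = 0 ∨ aQ = 1) (hb : Balance v v' e aT aQ)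
    (hord : aT = 0 ∨ aT = e) : v' = v ∧ (aT = 0 ↔ aQ = 0) := by
  unfold TypeWithIndex Balance at *
  rcases hv with ⟨h | h, he⟩ | ⟨h | h, he⟩ | ⟨h | h, he⟩ <;> subst h <;> subst he <;>
    rcases hv' with ⟨h' | h', he'⟩ | ⟨h' | h', he'⟩ | ⟨h' | h', he'⟩ <;> subst h' <;>
    rcases haQ with hq | hq <;> subst hq <;> rcases hord with ho | ho <;> omega

/-- (D1) SUPERSINGULAR rows (and in general): if the type CHANGES then it changes to the starred
partner `12 − v`, and the step goes unstarred → starred exactly when `a_ℚ = 1` (`aQ = 0`), starred →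
unstarred exactly when `a_ℚ = p`.  Hence on supersingular rows (where the type always changes, note §2(b))
"the isogeny out of the optimal curve has `a_ℚ = 1`" ⟺ "the optimal curve is the unstarred member"
(route item K15a `SupersingularStrongIsUnstarred` read as (NX)). -/
theorem swap_step (v v' e aT aQ : ℤ) (hv : TypeWithIndex v e) (hv' : TypeWithIndex v' e)
    (haT : 0 ≤ aT ∧ aT ≤ e) (haQ : aQ = 0 ∨ aQ = 1) (hb : Balance v v' e aT aQ) (hne : v' ≠ v) :
    v' = 12 - v ∧ (aQ = 0 ↔ v < v') := by
  unfold TypeWithIndex Balance at *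
  rcases hv with ⟨h | h, he⟩ | ⟨h | h, he⟩ | ⟨h | h, he⟩ <;> subst h <;> subst he <;>
    rcases hv' with ⟨h' | h', he'⟩ | ⟨h' | h', he'⟩ | ⟨h' | h', he'⟩ <;> subst h' <;>
    rcases haQ with hq | hq <;> subst hq <;> omega

/-- The forced Oort–Tate numerators on a type-changing step: `(e, v → v', aT)` is one of
`(6, 2→10, 4)`, `(6, 10→2, 2)`, `(3, 4→8, 1)`, `(3, 8→4, 2)`, `(4, 3→9, 2)`, `(4, 9→3, 2)` — i.e. the
Hasse depth `(e − aT)/e` of the source is `1/3` for II and IV*, `2/3` for IV and II*, `1/2` for III, III*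
(note §2(c); matches `v₅(j) ∈ {1,2}` resp. `v₇(j − 1728) = 1`, census `data/hauptcheck.out`, 0 violations). -/
theorem forced_numerators (v v' e aT aQ : ℤ) (hv : TypeWithIndex v e) (hv' : TypeWithIndex v' e)
    (haT : 0 ≤ aT ∧ aT ≤ e) (haQ : aQ = 0 ∨ aQ = 1) (hb : Balance v v' e aT aQ) (hne : v' ≠ v) :
    (e = 6 ∧ v = 2 ∧ aT = 4 ∧ aQ = 0) ∨ (e = 6 ∧ v = 10 ∧ aT = 2 ∧ aQ = 1) ∨
    (e = 3 ∧ v = 4 ∧ aT = 1 ∧ aQ = 0) ∨ (e = 3 ∧ v = 8 ∧ aT = 2 ∧ aQ = 1) ∨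
    (e = 4 ∧ v = 3 ∧ aT = 2 ∧ aQ = 0) ∨ (e = 4 ∧ v = 9 ∧ aT = 2 ∧ aQ = 1) := by
  unfold TypeWithIndex Balance at *
  rcases hv with ⟨h | h, he⟩ | ⟨h | h, he⟩ | ⟨h | h, he⟩ <;> subst h <;> subst he <;>
    rcases hv' with ⟨h' | h', he'⟩ | ⟨h' | h', he'⟩ | ⟨h' | h', he'⟩ <;> subst h' <;>
    rcases haQ with hq | hq <;> subst hq <;> omega

/-- (D2′) OFF-CORNER ordinary dictionary (`e < p − 1`, Raynaud): with `ψ|_{I_p} = ω^b` the kernel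
character, the closure over `O_T` (`e_T = e`) is étale ⟺ `(p−1) ∣ e·b` and multiplicative ⟺
`(p−1) ∣ e·(b−1)`; exactly one holds off the corner.  Finite check of "exactly one" for the off-corner
ordinary cells `(p, e) ∈ {(7,3), (13,3), (13,4), (13,6)}` and every digit `b`: stated as the absence of a
digit satisfying both or neither, given that ordinary reduction forces one of them (input, note §2(d)). -/
theorem offcorner_not_both :
    ∀ pe ∈ [((7 : ℕ), (3 : ℕ)), (13, 3), (13, 4), (13, 6)],
      ∀ b < pe.1 - 1, ¬ ((pe.1 - 1) ∣ pe.2 * b ∧ (pe.1 - 1) ∣ pe.2 * (b + (pe.1 - 2))) := by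
  decide

/-- At the Kummer CORNER `e = p − 1` (`(p,e) ∈ {(5,4), (7,6)}`) both divisibilities hold for every digit:
the digit cannot decide étale vs multiplicative closure there (this is why route item I9
`OrdinaryCornerOptimalSerreTateDeep` needs the Serre–Tate / Hauptmodul position instead). -/
theorem corner_both :
    ∀ pe ∈ [((5 : ℕ), (4 : ℕ)), (7, 6)],
      ∀ b < pe.1 - 1, (pe.1 - 1) ∣ pe.2 * b ∧ (pe.1 - 1) ∣ pe.2 * (b + (pe.1 - 2)) := by
  decide

end Summit.BirchSwinnertonDyer.BirchSwinnertonDyer.Cruxes.EisensteinAdditiveManinResidual.DigitLaw
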